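import Literature.AlgebraicGeometry.AbelianVarieties.InvariantDivisorDescentMulTwo
import Literature.AlgebraicGeometry.AbelianVarieties.TranslationEigenDivisor
import Literature.AlgebraicGeometry.AbelianVarieties.NeronSeveriHalfOfTwoTorsionInvariant
import HarnessLib

/-!
# The Néron–Severi half of a `2`-torsion-invariant class (Mumford §23 Thm. 3 at `n = 2`)

Layer `Literature/AlgebraicGeometry/AbelianVarieties`, namespace `Literature.AlgebraicGeometry.Motives.AbelianVariety`.  THEOREMS
ONLY (no definition, no named fact, no instance, no `sorry`).  This file only COMPOSES:

* **`AbelianVariety.exists_forall_linEquiv_two_smul_of_isSection`** — [MumfordAV1970] §23 Thm. 3 (p. 231) at `n = 2` in divisor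
  form, for an abelian variety `A` over an algebraically closed field `Ω` of characteristic `0`: if `t_x^*Θ ∼ Θ` for every `x` with
  `x² = 1` and an ODD multiple `N•Θ` has a non-zero section, then `[Θ] ∈ 2·NS`, i.e. there is `Θ₁` with
  `t_a^*Θ + 2•Θ₁ ∼ Θ + 2•t_a^*Θ₁` for all `a ∈ A(Ω)` — the hypothesis `hH2` of ★ G4 `AbelianSchemes/IsLambdaOfAtSquareRoot`
  VERBATIM.  Proof = ★ G1 `exists_isSection_forall_sameDivisor_pullback_translation` (an EFFECTIVE `E = 2N•Θ + div w` invariant AS A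
  DIVISOR under `A[2](Ω)`, from the section `s₀²` of `2N•Θ`; `A[2](Ω)` is finite, ★ `natCard_torsionPoints_eq_of_isAlgClosed`) → ★ G2
  `exists_linEquiv_pullback_two_of_forall_twoTorsion_sameDivisor` (`[2]^*Θ₀ ∼ E ∼ 2N•Θ`) → ★ G3 `exists_forall_linEquiv_two_smul`
  (the pointwise halving, `N` odd).
Purpose (cell `hodgecm-mathlib`, D-0151; the (V)-upgrade leaf of road (ii-a″) «theta functions without theta groups», file G5 of
B-p03 (g17)'s memo `CENSUS-Vup-HalfOfLambda` §2; B-plan1 (g16) 08:22:23Z / 08:28:18Z): the hypothesis `hH2` of ★ G4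
`AbelianSchemes/IsLambdaOfAtSquareRoot` is this theorem, so G4's (V)-upgrade heads become unconditional (G4 ed. 2).  Count-neutral; HC_CM is proved only modulo the 7 printed citations until rung 0 closes.

## References
* [MumfordAV1970] D. Mumford, *Abelian Varieties* (1970), §23 Thm. 3 (p. 231), §7 Thm. 4 (p. 72), §6 Application 3 (Proposition p. 64).
* [MumfordFogartyKirwan1994] D. Mumford, J. Fogarty, F. Kirwan, *Geometric Invariant Theory*, 3rd ed. (1994), Ch. 6 §2 Def. 6.3
  (p. 120), Ch. 7 §2 Prop. 7.3 step (V) (p. 134).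
-/

set_option autoImplicit false

noncomputable section

universe u

open CategoryTheory CategoryTheory.Limits AlgebraicGeometry MonoidalCategory
open scoped MonObj

/-! ## The Néron–Severi half, for every abelian variety over an algebraically closed field of characteristic `0` -/

namespace Literature.AlgebraicGeometry.Motives.AbelianVariety

open Literature.AlgebraicGeometry.AbelianVarieties

variable {Ω : Type u} [Field Ω] [IsAlgClosed Ω] [CharZero Ω] (A : AbelianVariety Ω)

/-- **[MumfordAV1970] §23 Thm. 3 at `n = 2`, divisor form — the Néron–Severi HALF of a `2`-torsion-invariant class.**  Let `Θ` be a
Cartier divisor on the abelian variety `A` over the algebraically closed field `Ω` of characteristic `0` with `t_x^*Θ ∼ Θ` for every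
`x ∈ A(Ω)` with `x² = 1`, and suppose an odd multiple `N•Θ` carries a non-zero section `s₀`.  Then there is `Θ₁` with
`t_a^*Θ + 2•Θ₁ ∼ Θ + 2•t_a^*Θ₁` for all `a ∈ A(Ω)` (`Λ(Θ) = 2Λ(Θ₁)` pointwise).  Proof: the theta-function divisor `E = 2N•Θ + div w ≥ 0`
of ★ G1 is invariant as a divisor under `A[2](Ω)`, hence `E ∼ [2]^*Θ₀` (★ G2), and `[2]^*Θ₀ ∼ 2N•Θ` with `N` odd halves (★ G3).
[cite: MumfordAV1970, §23 Thm. 3 (p. 231)] [cite: MumfordAV1970, §7 Thm. 4 (p. 72)] -/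
theorem exists_forall_linEquiv_two_smul_of_isSection (Θ : CartierDivisor A.X.left)
    (hK : ∀ x : A.Points Ω, x * x = 1 → (Θ.pullback (A.translation x).left).LinEquiv Θ)
    (N : ℕ) (s₀ : A.X.left.functionField) (hN : Odd N) (hs₀ : s₀ ≠ 0) (hsec : (N • Θ).IsSection s₀) :
    ∃ Θ₁ : CartierDivisor A.X.left, ∀ a : A.Points Ω,
      ((Θ.pullback (A.translation a).left) + 2 • Θ₁).LinEquiv (Θ + 2 • (Θ₁.pullback (A.translation a).left)) := by
  classical
  have h2 : (2 : Ω) ≠ 0 := two_ne_zero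
  -- the finite set `T = A[2](Ω)`
  haveI : Finite (A.torsionPoints Ω 2) := by
    apply Nat.finite_of_card_ne_zero
    rw [A.natCard_torsionPoints_eq_of_isAlgClosed Ω 2 (by exact_mod_cast h2)]
    exact pow_ne_zero _ (by decide)
  have hfin : (A.torsionPoints Ω 2 : Set (A.Points Ω)).Finite := Set.toFinite _
  let T : Finset (A.Points Ω) := hfin.toFinset
  have hTmem : ∀ x : A.Points Ω, x ∈ T ↔ x * x = 1 := fun x => by
    rw [Set.Finite.mem_toFinset, SetLike.mem_coe, mem_torsionPoints_iff, zpow_ofNat, pow_two]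
  -- the theta-function divisor `E = 2N•Θ + div w ≥ 0`, invariant as a divisor under `A[2](Ω)` (★ G1)
  have hsec2 : ((2 * N) • Θ).IsSection (s₀ ^ 2) := by
    rw [mul_comm]; exact CartierDivisor.IsSection.pow (D := Θ) hsec 2
  obtain ⟨w, hw, hwsec, hwinv⟩ := AbelianVarieties.AbelianVariety.exists_isSection_forall_sameDivisor_pullback_translation A Θ
    h2 T (fun x hx => (hTmem x).1 hx) (fun x hx => hK x ((hTmem x).1 hx)) (even_two_mul N) (pow_ne_zero 2 hs₀) hsec2
  have hE : ((2 * N) • Θ + CartierDivisor.principal w hw).IsEffective :=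
    (CartierDivisor.isEffective_add_principal_iff hw).2 hwsec
  have hinv : ∀ x ∈ A.torsionPoints Ω 2,
      (((2 * N) • Θ + CartierDivisor.principal w hw).pullback (A.translation x).left).SameDivisor
        ((2 * N) • Θ + CartierDivisor.principal w hw) := fun x hx =>
    hwinv x ((hTmem x).2 (by rwa [mem_torsionPoints_iff, zpow_ofNat, pow_two] at hx))
  -- descend through `[2]` (★ G2) and halve (★ G3)
  haveI : IsDominant (Hom.toSchemeHom ((2 : ℤ) • 𝟙 A)) := by
    have := A.isDominant_toSchemeHom_zsmul_of_ne_zero (N := 2) (by exact_mod_cast h2)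
    rwa [Nat.cast_ofNat] at this
  obtain ⟨Θ₀, hΘ₀⟩ := A.exists_linEquiv_pullback_two_of_forall_twoTorsion_sameDivisor _ hE hinv
  have hlin : (Θ₀.pullback (Hom.toSchemeHom ((2 : ℤ) • 𝟙 A))).LinEquiv ((2 * N) • Θ) :=
    hΘ₀.trans (CartierDivisor.LinEquiv.symm ⟨w, hw, CartierDivisor.SameDivisor.refl _⟩)
  exact A.exists_forall_linEquiv_two_smul h2 Θ Θ₀ hN hlin

end Literature.AlgebraicGeometry.Motives.AbelianVariety


end
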